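import Literature.AnabelianGeometry.EtaleTheta.Thm56SubdagCodomainsProofs
import Literature.AnabelianGeometry.EtaleTheta.Thm56SubdagReachable
import HarnessLib

/-!
# [EtTh] Prop. 5.5, varying codomains — glue to abc-iut-w5-d123's `ReachableFromCodomains` (abc-iut L2, K4 sequel)

PROOF-ONLY. `Thm56Sub.cyclotomicRigidityCod_of` (abc-iut-w5-d020, p420518) states its reachability hypothesis in the
exact shape of abc-iut-w5-d123's `FrobenioidCyclotomicRigidity.ReachableFromCodomains` (p420111, landed in parallel);
this file records the composition BY NAME, and the fixed-source special case through abc-iut-L2-t4's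
`LinearlyReachableFromBN` (d123's `reachableFromCodomains_of_linearlyReachableFromBN`), so that consumers cite one
theorem per currency (ruling F-w5d123-3 / finding F-w5d020-1).  No new definitions.
[cite: MochizukiEtTh2009, Prop 5.5 p.327–328 (PDF pp.101–102)]
-/

namespace Literature.AnabelianGeometry.EtaleTheta

open CategoryTheory
open FrobenioidCyclotomicRigidity

universe w v v' u u'

namespace ThetaFrobenioid

namespace Thm56Sub

variable {C : Type u} [Category.{v} C] {D : Type u'} [Category.{v'} D] {𝔉 : ThetaFrobenioid.{w} C D}
  {IsCod : C → Prop}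

/-- **[EtTh] Prop. 5.5 in the varying-codomain currency, from `ReachableFromCodomains` by name**: existence and
uniqueness (relative to the native isomorphisms `ν` at ALL admissible `l·N`-codomains) of the rigidity family, from
abc-iut-w5-d123's print-faithful reachability `ReachableFromCodomains 𝔉 IsCod` ([EtTh] p.328: every theta-saturated `S`
receives a linear `S″ → S` from SOME admissible codomain), transport independence, and the transport laws.
[cite: MochizukiEtTh2009, Prop 5.5 p.327–328 (PDF pp.101–102)] -/
theorem cyclotomicRigidityCod_of_reachable (hcodSat : ∀ S'', IsCod S'' → 𝔉.IsThetaSaturated S'')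
    (ν : NativeIsoFamily 𝔉 IsCod) (hreach : ReachableFromCodomains 𝔉 IsCod) (hind : TransportIndependentCod 𝔉 ν)
    (hUc : UnitsPullComp 𝔉) (hUi : UnitsPullId 𝔉) (hLc : LDeltaMapComp 𝔉) (hLi : LDeltaMapId 𝔉) :
    CyclotomicRigidityCod 𝔉 hcodSat ν :=
  cyclotomicRigidityCod_of hcodSat ν hreach hind hUc hUi hLc hLi

/-- Uniqueness half alone, from `ReachableFromCodomains` by name (no transport-independence needed): two rigidity
families Kummer-determined at all admissible codomains and functorial for linear morphisms coincide.
[cite: MochizukiEtTh2009, Prop 5.5 p.327–328 (PDF pp.101–102)] -/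
theorem rigidityFamilyCod_unique_of_reachable (hcodSat : ∀ S'', IsCod S'' → 𝔉.IsThetaSaturated S'')
    (hreach : ReachableFromCodomains 𝔉 IsCod) (ν : NativeIsoFamily 𝔉 IsCod) {ρ ρ' : RigidityFamily 𝔉}
    (hK : IsKummerDeterminedCod 𝔉 hcodSat ν ρ) (hρ : IsFunctorialLinear 𝔉 ρ)
    (hK' : IsKummerDeterminedCod 𝔉 hcodSat ν ρ') (hρ' : IsFunctorialLinear 𝔉 ρ') : ρ = ρ' :=
  rigidityFamilyCod_unique_of hcodSat hreach ν hK hρ hK' hρ'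

/-- **The fixed-source special case**: when `B_N` itself is an admissible codomain and abc-iut-L2-t4's
`LinearlyReachableFromBN 𝔉` holds, Prop. 5.5 in the varying-codomain currency follows (via abc-iut-w5-d123's
`reachableFromCodomains_of_linearlyReachableFromBN`).  [cite: MochizukiEtTh2009, Prop 5.5 p.327–328 (PDF pp.101–102)] -/
theorem cyclotomicRigidityCod_of_linearlyReachableFromBN (hcodSat : ∀ S'', IsCod S'' → 𝔉.IsThetaSaturated S'')
    (hBcod : IsCod 𝔉.BN) (ν : NativeIsoFamily 𝔉 IsCod) (hreach : LinearlyReachableFromBN 𝔉)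
    (hind : TransportIndependentCod 𝔉 ν) (hUc : UnitsPullComp 𝔉) (hUi : UnitsPullId 𝔉) (hLc : LDeltaMapComp 𝔉)
    (hLi : LDeltaMapId 𝔉) : CyclotomicRigidityCod 𝔉 hcodSat ν :=
  cyclotomicRigidityCod_of_reachable hcodSat ν (reachableFromCodomains_of_linearlyReachableFromBN 𝔉 hBcod hreach)
    hind hUc hUi hLc hLi

end Thm56Sub

end ThetaFrobenioid

end Literature.AnabelianGeometry.EtaleTheta
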